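import Summits.QuantumFields.BalabanUV.T4Continuum.Support.VariationalVectorOneStepEnd
import Summits.QuantumFields.BalabanUV.T4Continuum.Support.VariationalVectorFederbushPhys
import Summits.QuantumFields.BalabanUV.T4Continuum.Support.VariationalCovariantOneStepPhys

/-!
# T⁴ programme, spine node NE2 (U1a), lane P2 — SUPPLIER LEAF V-ONE FOR E-VALUED 1-FORMS («V-ONE-1F»), file 5: PHYSICAL UNITS AND THE `blockSpin`
# READING — THE CURL HALF OF THE `hONE` BINDER OF `vector_pair_bracket_sqrt`, and the whole binder from leaf V-GF's displayed shape

NE2 formalisation swarm `b2b-balaban-t4-ne2-formalise-*`, leaf prover 01 GEN 6 (`prover-b2b-balaban-t4-ne2-formalise-leaf-01-g6-0`); file 5 of the V-ONE-1F line: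
file 4's lattice END `curlSq_interpV_le` rescaled to the road owner's letters `ScV ∕ SfV ∕ qWV` of `VariationalVectorForm` (p216339, decision (D2):
`ScV n M R G W = n^{−d}·(n²·(½·curlSq R W + G W))`) by leaf-01-g2's `VariationalCovariantOneStepPhys.scale_sq_sqrt_add` BY NAME, and read through
`VariationalTransfer.blockSpin` with file 1's EXACT constraint `QvL_interpV`.

THE STATEMENTS (model level; `E` a Hilbert space; coarse level `n` = `Tor (fine n M)`, fine level `n·L` = `Tor (fine L (fine n M))`; `U′` unitary site frames,
`Rc` unitary coarse bond operators with plaquette defect `≤ p`, fine bond operators `R′` with the two frame defects `≤ m`; `ρ_V(W) := n⁴∕n^d·hessV W`):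
 * **`SfV_interpV_le`** (THE CURL HALF; any `G ≥ 0` on the coarse side, `G′ = 0` on the fine side):
   `SfV n L M R′ 0 (Λ′_W) ≤ ( √( ScV n M Rc G W + 4(d+26)·(L∕n²)·ρ_V W ) + n·L·√(d(50p²∕L + (32(1+d²)+400)m²)∕2)·√(qWV n M W) )²`;
 * **`blockSpin_Q1_le`**: the same for `blockSpin (QvL L (fine n M) (frameT U′ Rc)) (SfV n L M R′ 0) W` — the `hONE` binder of
   `VariationalVectorForm.vector_pair_bracket_sqrt` for the PURE CURL form at the fine level, `Q₁ := QvL (frameT U′ Rc)`, `ρ := ρ_V`,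
   `ε₁ = 4(d+26)·L∕n²`, `δ′ = n·L·√(d(50p²∕L + (32(1+d²)+400)m²)∕2)`;
 * **`blockSpin_Q1_le_of_GF`** (THE WHOLE BINDER from leaf V-GF's shape): if the DATA functional `G′` passes the interpolant in the same currency,
   (GF2′) `(nL)^{−d}(nL)²·G′(Λ′_W) ≤ ( √(n^{−d}n²·G W + ε_G·ρ_V W) + δ_G·√(qWV W) )²` (displayed hypothesis — leaf V-GF, NOT proved here), then
   `blockSpin Q₁ (SfV n L M R′ G′) W ≤ ( √( ScV n M Rc G W + (4(d+26)L∕n² + ε_G)·ρ_V W ) + (δ′ + δ_G)·√(qWV W) )²` (`sq_sqrt_add_sq_sqrt_add_le`, leaf-01-g5).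
NOT HERE: general (non-adapted) line transports (repair by V-UB-L, a later file), the sizes of `(m, p)` for Bałaban's class (taxi ∕ CLASS lineage), V-REG for `ρ_V`.

HONEST FRAMING (T4-DAG p. 1).  Model level (frames ∕ transports ∕ `G`, `G′` DATA); [folklore] rescaling; nothing printed is a hypothesis; data `def` `rhoV` only, no
`def … : Prop`, no `sorry`; axioms standard.  V-ONE is proved here ONLY for the curl form and frame-adapted line transports; (GF2′) displayed; NE2 NOT proved; spine
PROVED 0∕9; rung (B)+1 finite T⁴ — NOT infinite volume, NOT mass gap, NOT Clay.  HONEST DEPENDENCY (cell, verbatim): continuum YM on T⁴ ⇐ BetaPertH ∧ nine spine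
estimates (0/9 proved); BetaPertH ⇐ (D1) ∧ (D4) ∧ CAP+tail; G-an2-4 gates asym, D1 and NE2/3/4.
-/

noncomputable section

namespace Summit.QuantumFields.BalabanUV.T4Continuum.VariationalVectorOneStepPhys

open Finset
open Literature.MathematicalPhysics.QuantumFieldTheory.Balaban1983to89
open Literature.MathematicalPhysics.QuantumFieldTheory.Balaban1983to89.B5Prop11Plancherel (Tor fine unitVec)
open Literature.MathematicalPhysics.QuantumFieldTheory.Balaban1983to89.B5Block118 (bpt)
open Summit.QuantumFields.BalabanUV.T4Continuum.VariationalTransfer (blockSpin blockSpin_le)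
open Summit.QuantumFields.BalabanUV.T4Continuum.VariationalColourFederbush (norm_le_one_of_mem_unitary)
open Summit.QuantumFields.BalabanUV.T4Continuum.VariationalCovariantOneStepPhys (scale_sq_sqrt_add)
open Summit.QuantumFields.BalabanUV.T4Continuum.VectorBlockTrialForm (nsqV nsqV_nonneg QvL)
open Summit.QuantumFields.BalabanUV.T4Continuum.VariationalVectorForm (curlSq curlSq_nonneg ScV SfV qWV ScV_nonneg SfV_nonneg qWV_nonneg)
open Summit.QuantumFields.BalabanUV.T4Continuum.VariationalVectorFederbush (sq_sqrt_add_sq_sqrt_add_le)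
open Summit.QuantumFields.BalabanUV.T4Continuum.VariationalVectorInterpolant (interpV frameT QvL_interpV)
open Summit.QuantumFields.BalabanUV.T4Continuum.VariationalVectorOneStep (plaq hessV hessV_nonneg curlSq_interpV_le)

variable {d : ℕ} {E : Type*} [NormedAddCommGroup E] [InnerProductSpace ℂ E] [CompleteSpace E]
variable (n L : ℕ) [NeZero n] [NeZero L] (M : Fin d → ℕ) [hM : ∀ μ, NeZero (M μ)]

/-! ## §1 The regularity functional of leaf V-ONE-1F in physical units -/

/-- the regularity functional of leaf V-ONE-1F at level `n`: `ρ_V(W) = n⁴∕n^d · hessV W` (the 1-form twin of `VariationalColourOneStepPhys.rhov`). [folklore] -/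
def rhoV (Rc : Tor (fine n M) → Fin d → (E →L[ℂ] E)) (W : Tor (fine n M) → Fin d → E) : ℝ :=
  (n : ℝ) ^ 4 / (n : ℝ) ^ d * hessV (fine n M) Rc W

omit [CompleteSpace E] in
/-- `ρ_V ≥ 0`. [folklore] -/
theorem rhoV_nonneg (Rc : Tor (fine n M) → Fin d → (E →L[ℂ] E)) (W : Tor (fine n M) → Fin d → E) : 0 ≤ rhoV n M Rc W :=
  mul_nonneg (by positivity) (hessV_nonneg _ _ _)

/-! ## §2 The curl half of `hONE` in physical units, and its block-spin reading -/

variable {Rc : Tor (fine n M) → Fin d → (E →L[ℂ] E)} {R' : Tor (fine L (fine n M)) → Fin d → (E →L[ℂ] E)}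
variable {U' : Tor (fine L (fine n M)) → (E →L[ℂ] E)} {m p : ℝ}

/-- **LEAF V-ONE-1F, THE CURL HALF (physical units)**: for any `G ≥ 0` on the coarse side,
`SfV n L M R′ 0 (Λ′_W) ≤ ( √( ScV n M Rc G W + 4(d+26)·(L∕n²)·ρ_V W ) + n·L·√(d(50p²∕L + (32(1+d²)+400)m²)∕2)·√(qWV n M W) )²`. [folklore] -/
theorem SfV_interpV_le (hU : ∀ x, U' x ∈ unitary (E →L[ℂ] E)) (hRc1 : ∀ y μ, Rc y μ ∈ unitary (E →L[ℂ] E)) (hm : 0 ≤ m)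
    (hin : ∀ (y : Tor (fine n M)) (j : Fin d → Fin L) (μ : Fin d), (j μ : ℕ) + 1 < L →
      ‖R' (bpt L (fine n M) y j) μ * star (U' (bpt L (fine n M) y j + unitVec (fine L (fine n M)) μ)) - star (U' (bpt L (fine n M) y j))‖ ≤ m)
    (hcross : ∀ (y : Tor (fine n M)) (j : Fin d → Fin L) (μ : Fin d), (j μ : ℕ) + 1 = L →
      ‖R' (bpt L (fine n M) y j) μ * star (U' (bpt L (fine n M) y j + unitVec (fine L (fine n M)) μ))
        - star (U' (bpt L (fine n M) y j)) * Rc y μ‖ ≤ m)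
    (hp : ∀ y μ ν, ‖plaq (fine n M) Rc y μ ν‖ ≤ p) {G : (Tor (fine n M) → Fin d → E) → ℝ} (hG0 : ∀ W, 0 ≤ G W)
    (W : Tor (fine n M) → Fin d → E) :
    SfV n L M R' (fun _ => 0) (interpV L (fine n M) U' Rc W)
      ≤ (Real.sqrt (ScV n M Rc G W + 4 * ((d : ℝ) + 26) * ((L : ℝ) / (n : ℝ) ^ 2) * rhoV n M Rc W)
          + (n : ℝ) * L * Real.sqrt (d * (50 * p ^ 2 / L + (32 * (1 + (d : ℝ) ^ 2) + 400) * m ^ 2) / 2) * Real.sqrt (qWV n M W)) ^ 2 := by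
  have hn : (0 : ℝ) < n := by exact_mod_cast Nat.pos_of_ne_zero (NeZero.ne n)
  have hL : (0 : ℝ) < L := by exact_mod_cast Nat.pos_of_ne_zero (NeZero.ne L)
  have hnd : (0 : ℝ) < (n : ℝ) ^ d := pow_pos hn d
  have hLd : (0 : ℝ) < (L : ℝ) ^ d := pow_pos hL d
  have hnLd : (0 : ℝ) < ((n : ℝ) * L) ^ d := pow_pos (mul_pos hn hL) d
  have hs0 : 0 ≤ ((n : ℝ) * L) ^ 2 / ((n : ℝ) * L) ^ d / 2 := by positivity
  have hC0 : 0 ≤ curlSq (fine n M) Rc W := curlSq_nonneg _ _ _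
  have hH0 : 0 ≤ hessV (fine n M) Rc W := hessV_nonneg _ _ _
  have hq0 : 0 ≤ nsqV (fine n M) W := nsqV_nonneg _ W
  have hK0 : 0 ≤ 50 * p ^ 2 / L + (32 * (1 + (d : ℝ) ^ 2) + 400) * m ^ 2 := by positivity
  have hlat := curlSq_interpV_le L (fine n M) W hU hRc1 hm hin hcross hp
  have hSf : SfV n L M R' (fun _ => 0) (interpV L (fine n M) U' Rc W)
      = ((n : ℝ) * L) ^ 2 / ((n : ℝ) * L) ^ d / 2 * curlSq (fine L (fine n M)) R' (interpV L (fine n M) U' Rc W) := by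
    unfold SfV; ring
  -- main part: `s·P = (ScV − G-part) + ε₁ρ ≤ ScV + ε₁ρ`
  have hsP : ((n : ℝ) * L) ^ 2 / ((n : ℝ) * L) ^ d / 2
        * ((L : ℝ) ^ d / (L : ℝ) ^ 2 * curlSq (fine n M) Rc W + 8 * ((d : ℝ) + 26) * ((L : ℝ) ^ d / L) * hessV (fine n M) Rc W)
      = ((n : ℝ) ^ d)⁻¹ * ((n : ℝ) ^ 2 * (curlSq (fine n M) Rc W / 2)) + 4 * ((d : ℝ) + 26) * ((L : ℝ) / (n : ℝ) ^ 2) * rhoV n M Rc W := by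
    unfold rhoV; rw [mul_pow]; field_simp; ring
  have hSc : ((n : ℝ) ^ d)⁻¹ * ((n : ℝ) ^ 2 * (curlSq (fine n M) Rc W / 2)) ≤ ScV n M Rc G W := by
    unfold ScV; have := hG0 W; gcongr; linarith
  -- defect part
  have hsQ : Real.sqrt (((n : ℝ) * L) ^ 2 / ((n : ℝ) * L) ^ d / 2)
        * Real.sqrt (d * (L : ℝ) ^ d * (50 * p ^ 2 / L + (32 * (1 + (d : ℝ) ^ 2) + 400) * m ^ 2) * nsqV (fine n M) W)
      = (n : ℝ) * L * Real.sqrt (d * (50 * p ^ 2 / L + (32 * (1 + (d : ℝ) ^ 2) + 400) * m ^ 2) / 2) * Real.sqrt (qWV n M W) := by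
    have hqW : qWV n M W = ((n : ℝ) ^ d)⁻¹ * nsqV (fine n M) W := rfl
    rw [← Real.sqrt_mul hs0]
    have e1 : ((n : ℝ) * L) ^ 2 / ((n : ℝ) * L) ^ d / 2 * (d * (L : ℝ) ^ d * (50 * p ^ 2 / L + (32 * (1 + (d : ℝ) ^ 2) + 400) * m ^ 2) * nsqV (fine n M) W)
        = ((n : ℝ) * L) ^ 2 * ((d * (50 * p ^ 2 / L + (32 * (1 + (d : ℝ) ^ 2) + 400) * m ^ 2) / 2) * qWV n M W) := by
      rw [hqW, mul_pow]; field_simp; ring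
    rw [e1, Real.sqrt_mul (sq_nonneg _), Real.sqrt_sq (by positivity), Real.sqrt_mul (by positivity)]
    ring
  rw [hSf]
  refine (mul_le_mul_of_nonneg_left hlat hs0).trans ?_
  rw [scale_sq_sqrt_add hs0, hsP, hsQ]
  have h0 : 0 ≤ Real.sqrt (((n : ℝ) ^ d)⁻¹ * ((n : ℝ) ^ 2 * (curlSq (fine n M) Rc W / 2)) + 4 * ((d : ℝ) + 26) * ((L : ℝ) / (n : ℝ) ^ 2) * rhoV n M Rc W)
      + (n : ℝ) * L * Real.sqrt (d * (50 * p ^ 2 / L + (32 * (1 + (d : ℝ) ^ 2) + 400) * m ^ 2) / 2) * Real.sqrt (qWV n M W) := by positivity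
  exact pow_le_pow_left₀ h0 (add_le_add (Real.sqrt_le_sqrt (by linarith)) le_rfl) 2

/-- **LEAF V-ONE-1F — THE BLOCK-SPIN READING (the CURL HALF of `hONE`)**: with `Q₁ := QvL L (fine n M) (frameT U′ Rc)` (file 1's frame-adapted line
transports; the constraint holds EXACTLY for the competitor), for every coarse 1-form `W` and any `G ≥ 0` on the coarse side,
`blockSpin Q₁ (SfV n L M R′ 0) W ≤ ( √( ScV n M Rc G W + 4(d+26)·(L∕n²)·ρ_V W ) + n·L·√(d(50p²∕L + (32(1+d²)+400)m²)∕2)·√(qWV n M W) )²` —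
the `hONE` binder of `VariationalVectorForm.vector_pair_bracket_sqrt` for the pure curl form with `ρ := ρ_V`, `ε₁ = 4(d+26)L∕n²`,
`δ′ = nL√(d(50p²∕L + (32(1+d²)+400)m²)∕2)`.  Every torus, every level; NO `k`, NO NE3. [folklore] -/
theorem blockSpin_Q1_le (hU : ∀ x, U' x ∈ unitary (E →L[ℂ] E)) (hRc1 : ∀ y μ, Rc y μ ∈ unitary (E →L[ℂ] E)) (hm : 0 ≤ m)
    (hin : ∀ (y : Tor (fine n M)) (j : Fin d → Fin L) (μ : Fin d), (j μ : ℕ) + 1 < L →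
      ‖R' (bpt L (fine n M) y j) μ * star (U' (bpt L (fine n M) y j + unitVec (fine L (fine n M)) μ)) - star (U' (bpt L (fine n M) y j))‖ ≤ m)
    (hcross : ∀ (y : Tor (fine n M)) (j : Fin d → Fin L) (μ : Fin d), (j μ : ℕ) + 1 = L →
      ‖R' (bpt L (fine n M) y j) μ * star (U' (bpt L (fine n M) y j + unitVec (fine L (fine n M)) μ))
        - star (U' (bpt L (fine n M) y j)) * Rc y μ‖ ≤ m)
    (hp : ∀ y μ ν, ‖plaq (fine n M) Rc y μ ν‖ ≤ p) {G : (Tor (fine n M) → Fin d → E) → ℝ} (hG0 : ∀ W, 0 ≤ G W)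
    (W : Tor (fine n M) → Fin d → E) :
    blockSpin (QvL L (fine n M) (frameT L (fine n M) U' Rc)) (SfV n L M R' (fun _ => 0)) W
      ≤ (Real.sqrt (ScV n M Rc G W + 4 * ((d : ℝ) + 26) * ((L : ℝ) / (n : ℝ) ^ 2) * rhoV n M Rc W)
          + (n : ℝ) * L * Real.sqrt (d * (50 * p ^ 2 / L + (32 * (1 + (d : ℝ) ^ 2) + 400) * m ^ 2) / 2) * Real.sqrt (qWV n M W)) ^ 2 := by
  have hQ : QvL L (fine n M) (frameT L (fine n M) U' Rc) (interpV L (fine n M) U' Rc W) = W := QvL_interpV L (fine n M) Rc W hU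
  exact (blockSpin_le (SfV_nonneg n L M R' fun _ => le_rfl) hQ).trans (SfV_interpV_le n L M hU hRc1 hm hin hcross hp hG0 W)

/-- **LEAF V-ONE-1F, `∃`-form**: the competitor exhibited — `∃ W′, Q₁ W′ = W ∧ SfV n L M R′ 0 W′ ≤ (…)²`. [folklore] -/
theorem exists_oneStep_vector (hU : ∀ x, U' x ∈ unitary (E →L[ℂ] E)) (hRc1 : ∀ y μ, Rc y μ ∈ unitary (E →L[ℂ] E)) (hm : 0 ≤ m)
    (hin : ∀ (y : Tor (fine n M)) (j : Fin d → Fin L) (μ : Fin d), (j μ : ℕ) + 1 < L →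
      ‖R' (bpt L (fine n M) y j) μ * star (U' (bpt L (fine n M) y j + unitVec (fine L (fine n M)) μ)) - star (U' (bpt L (fine n M) y j))‖ ≤ m)
    (hcross : ∀ (y : Tor (fine n M)) (j : Fin d → Fin L) (μ : Fin d), (j μ : ℕ) + 1 = L →
      ‖R' (bpt L (fine n M) y j) μ * star (U' (bpt L (fine n M) y j + unitVec (fine L (fine n M)) μ))
        - star (U' (bpt L (fine n M) y j)) * Rc y μ‖ ≤ m)
    (hp : ∀ y μ ν, ‖plaq (fine n M) Rc y μ ν‖ ≤ p) {G : (Tor (fine n M) → Fin d → E) → ℝ} (hG0 : ∀ W, 0 ≤ G W)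
    (W : Tor (fine n M) → Fin d → E) :
    ∃ W' : Tor (fine L (fine n M)) → Fin d → E, QvL L (fine n M) (frameT L (fine n M) U' Rc) W' = W ∧
      SfV n L M R' (fun _ => 0) W'
        ≤ (Real.sqrt (ScV n M Rc G W + 4 * ((d : ℝ) + 26) * ((L : ℝ) / (n : ℝ) ^ 2) * rhoV n M Rc W)
            + (n : ℝ) * L * Real.sqrt (d * (50 * p ^ 2 / L + (32 * (1 + (d : ℝ) ^ 2) + 400) * m ^ 2) / 2) * Real.sqrt (qWV n M W)) ^ 2 :=
  ⟨interpV L (fine n M) U' Rc W, QvL_interpV L (fine n M) Rc W hU, SfV_interpV_le n L M hU hRc1 hm hin hcross hp hG0 W⟩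

/-! ## §3 The whole `hONE` binder from leaf V-GF's displayed shape -/

/-- **LEAF V-ONE-1F — THE WHOLE `hONE` BINDER, MODULO LEAF V-GF**: if the DATA gauge ∕ curvature functional `G′` passes the tilted competitor in the same
additive square-root currency, (GF2′) `(nL)^{−d}(nL)²·G′(Λ′_W) ≤ ( √(n^{−d}n²·G W + ε_G·ρ_V W) + δ_G·√(qWV W) )²` (DISPLAYED — leaf V-GF's output, NOT proved
here), then with `Q₁ := QvL L (fine n M) (frameT U′ Rc)`,
`blockSpin Q₁ (SfV n L M R′ G′) W ≤ ( √( ScV n M Rc G W + (4(d+26)L∕n² + ε_G)·ρ_V W ) + (δ′ + δ_G)·√(qWV W) )²`. [folklore] -/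
theorem blockSpin_Q1_le_of_GF (hU : ∀ x, U' x ∈ unitary (E →L[ℂ] E)) (hRc1 : ∀ y μ, Rc y μ ∈ unitary (E →L[ℂ] E)) (hm : 0 ≤ m)
    (hin : ∀ (y : Tor (fine n M)) (j : Fin d → Fin L) (μ : Fin d), (j μ : ℕ) + 1 < L →
      ‖R' (bpt L (fine n M) y j) μ * star (U' (bpt L (fine n M) y j + unitVec (fine L (fine n M)) μ)) - star (U' (bpt L (fine n M) y j))‖ ≤ m)
    (hcross : ∀ (y : Tor (fine n M)) (j : Fin d → Fin L) (μ : Fin d), (j μ : ℕ) + 1 = L →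
      ‖R' (bpt L (fine n M) y j) μ * star (U' (bpt L (fine n M) y j + unitVec (fine L (fine n M)) μ))
        - star (U' (bpt L (fine n M) y j)) * Rc y μ‖ ≤ m)
    (hp : ∀ y μ ν, ‖plaq (fine n M) Rc y μ ν‖ ≤ p) {G : (Tor (fine n M) → Fin d → E) → ℝ} (hG0 : ∀ W, 0 ≤ G W)
    {G' : (Tor (fine L (fine n M)) → Fin d → E) → ℝ} (hG0' : ∀ W', 0 ≤ G' W') {εG δG : ℝ} (hεG : 0 ≤ εG) (hδG : 0 ≤ δG)
    (hGF : ∀ W, (((n : ℝ) * L) ^ d)⁻¹ * (((n : ℝ) * L) ^ 2 * G' (interpV L (fine n M) U' Rc W))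
      ≤ (Real.sqrt (((n : ℝ) ^ d)⁻¹ * ((n : ℝ) ^ 2 * G W) + εG * rhoV n M Rc W) + δG * Real.sqrt (qWV n M W)) ^ 2)
    (W : Tor (fine n M) → Fin d → E) :
    blockSpin (QvL L (fine n M) (frameT L (fine n M) U' Rc)) (SfV n L M R' G') W
      ≤ (Real.sqrt (ScV n M Rc G W + (4 * ((d : ℝ) + 26) * ((L : ℝ) / (n : ℝ) ^ 2) + εG) * rhoV n M Rc W)
          + ((n : ℝ) * L * Real.sqrt (d * (50 * p ^ 2 / L + (32 * (1 + (d : ℝ) ^ 2) + 400) * m ^ 2) / 2) + δG) * Real.sqrt (qWV n M W)) ^ 2 := by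
  have hn : (0 : ℝ) < n := by exact_mod_cast Nat.pos_of_ne_zero (NeZero.ne n)
  set W' := interpV L (fine n M) U' Rc W with hW'
  have hQ : QvL L (fine n M) (frameT L (fine n M) U' Rc) W' = W := QvL_interpV L (fine n M) Rc W hU
  -- the curl half with `G := 0` on the coarse side
  have hcurl := SfV_interpV_le n L M hU hRc1 hm hin hcross hp (G := fun _ => 0) (fun _ => le_rfl) W
  set a : ℝ := ScV n M Rc (fun _ => 0) W + 4 * ((d : ℝ) + 26) * ((L : ℝ) / (n : ℝ) ^ 2) * rhoV n M Rc W with ha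
  set b : ℝ := ((n : ℝ) ^ d)⁻¹ * ((n : ℝ) ^ 2 * G W) + εG * rhoV n M Rc W with hb
  set α : ℝ := (n : ℝ) * L * Real.sqrt (d * (50 * p ^ 2 / L + (32 * (1 + (d : ℝ) ^ 2) + 400) * m ^ 2) / 2) * Real.sqrt (qWV n M W) with hα
  set β : ℝ := δG * Real.sqrt (qWV n M W) with hβ
  have hρ0 := rhoV_nonneg n M Rc W
  have ha0 : 0 ≤ a := by have := ScV_nonneg n M Rc (G := fun _ => 0) (fun _ => le_rfl) W; positivity
  have hb0 : 0 ≤ b := by have := hG0 W; positivity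
  have hα0 : 0 ≤ α := by positivity
  have hβ0 : 0 ≤ β := by positivity
  have hsplit : SfV n L M R' G' W' = SfV n L M R' (fun _ => 0) W' + (((n : ℝ) * L) ^ d)⁻¹ * (((n : ℝ) * L) ^ 2 * G' W') := by
    unfold SfV; ring
  have hab : a + b = ScV n M Rc G W + (4 * ((d : ℝ) + 26) * ((L : ℝ) / (n : ℝ) ^ 2) + εG) * rhoV n M Rc W := by
    rw [ha, hb]; unfold ScV; ring
  have key := sq_sqrt_add_sq_sqrt_add_le ha0 hb0 hα0 hβ0
  refine (blockSpin_le (SfV_nonneg n L M R' hG0') hQ).trans ?_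
  rw [hsplit]
  calc SfV n L M R' (fun _ => 0) W' + (((n : ℝ) * L) ^ d)⁻¹ * (((n : ℝ) * L) ^ 2 * G' W')
      ≤ (Real.sqrt a + α) ^ 2 + (Real.sqrt b + β) ^ 2 := add_le_add hcurl (hGF W)
    _ ≤ (Real.sqrt (a + b) + (α + β)) ^ 2 := key
    _ = _ := by rw [hab, hα, hβ]; ring

end Summit.QuantumFields.BalabanUV.T4Continuum.VariationalVectorOneStepPhys

end
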